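import Literature.MathematicalPhysics.QuantumFieldTheory.Balaban1983to89.T4OutputRate

/-!
# Spine/NE4/OutputRateFrozenHistory — (R63) ONE LEVEL UP, in the typed currency of rows NE5 ∕ NE9: GIVEN the activity-level memory
# companion (`T4OutputRate.NE9` moduli with `T4OutputRate.FadingMemory`), the two-run output rate `T4OutputRate.NE5` reduces to its
# FROZEN-PREFIX form, and a frozen-prefix bound «gain θ₀ per frozen step × ANY finite loss Λ per live step» already gives NE5's
# geometric rate — no threshold (cell `pub-balaban-gaps`, seat ne4, generation 20; census item (R63) of `HOME/ne/NE4.md` §5 and its §8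
# item 37, the cross-row pointer made kernel-exact; β-level original = `Spine/NE4/ScaleShiftFrozenHistory.lean`)

HONEST FRAMING.  Bookkeeping for rung (B)+1 on ONE FIXED finite four-torus — NOT ℝ⁴, NOT infinite volume, NOT a mass gap, NOT
Clay.  NE5 (`T4OutputRate.NE5`) and NE9 (`T4OutputRate.NE9`) are the cell's NEW ESTIMATES, NOT PRINTED ([Balaban1987RG1] p. 263 gives
only «a C^∞-function of g_{j−1} … (or analytic)»; GAPS G-t4-U3-1 ∕ G-t4-U3-3) and NOT PROVED here; this file touches NO word of rows
NE5 ∕ NE9 — it is an implication between HYPOTHESIS SHAPES over the abstract `Carriers` ∕ `Functional` vocabulary; nothing of Bałaban's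
is instantiated or asserted; spine estimates proved 0∕9, unchanged.  0 sorry.

WHAT.  `NE5 EA EB W κ θ C₅` compares, AT THE SAME re-indexed coupling sequence `g ∈ W`, run A's scale-`j` output functional (background
transported) with run B's: `|EA g (transport U) X − EB g U X| ≤ C₅·θ^j·e^{−κ d(X)}`, `j = scale X`.  `NE9 E W κ Λ` gives history moduli
`Λ j i` for the influence of `g_i` (`i < j`) on `E g U X`, and `FadingMemory C₉ ω Λ` makes them fade like `ω^{j−i}`.  With BOTH runs'
functionals carrying such moduli, the oldest `m ≤ j` couplings of `g` may be FROZEN at one value `ε ∈ ]0,γ]` (e.g. `ε → 0⁺`) in both at the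
price `2·C₉γω^{j+1−m}∕(1−ω)·e^{−κd(X)}` (§1 `abs_sub_frzSeq_le`, §2 `outputShift_le_frozen`) — so, GIVEN the memory, NE5 ⟺ its
FROZEN-PREFIX form `FrozenNE5 EA EB γ κ φ` (§2; converse `frozenNE5_of_ne5`).  If the frozen comparison obeys `φ j m = a·Λ₁^{j−m}·θ₀^m`
— gain `θ₀ ≤ 1` per frozen step, loss `Λ₁ ≥ 0` OF ANY SIZE per live step — then the «p frozen : 1 live» split gives NE5 at every rate
`θ′` with `ω ≤ θ′^{p+1}`, `Λ₁θ₀^p ≤ θ′^{p+1}` (§3 `ne5_of_frozenNE5_root`), and SOME rate `θ′ < 1` whenever `ω < 1 ∧ θ₀ < 1`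
(`exists_ne5_of_frozenNE5`).  NO threshold couples `Λ₁` to `ω`.

WHAT THIS SAYS (pointer for the ne5 ∕ ne9 rows and the dagwriter; evidence, no word of any row moves).  Row NE9's census C24
(`Spine/NE9/MemoryFromRate.lean`) derives the MEMORY (in oscillation form) from the tower RATE; this file is the converse direction
modulo soft inputs: the RATE (NE5's `θ^j`) from the MEMORY (NE9 with fading) plus a frozen-prefix bound whose natural producer is
{settling of the FREE data at depth `m` (the frozen couplings at `ε → 0⁺`: Gaussian covariances ∕ propagators, rows NE2∕NE3's LINEAR
η-difference theory) × Lipschitz STABILITY of the live interacting steps in their input with ANY k-uniform constant (the Cauchy-estimate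
currency of [Balaban1988RG2Cluster] Lemma 3 (2.38)'s analyticity — ne5's route P1 WITHOUT its renewal threshold, because the memory is
given rather than derived)}.  So RATE (NE4∕NE5) and MEMORY (node U2's companion ∕ NE9's decay) are ONE unprinted estimate in two currencies:
whichever is paid in full on Bałaban's carriers, the other follows modulo {linear η-difference theory, printed-type stability ∕
regularity}.  READING of «frozen = free» is heuristic and labelled so; the hypothesis allows any freezing value.

References (TYPES only): [Balaban1987RG1] = T. Bałaban, Commun. Math. Phys. **109** (1987) 249–301, (0.24)–(0.25) p. 257, (1.18) p. 263,
§5 p. 298; [Balaban1988RG2Cluster] = CMP **116** (1988) 1–22, Lemma 3 (2.38) p. 20; C. King, CMP **102** (1986) Thm 3.4 (3.9) p. 656 and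
(3.73) p. 665 (shape only).
-/

noncomputable section

open Finset

namespace Summit.QuantumFields.BalabanUV.T4Continuum.Spine.NE4.OutputRateFrozenHistory

open Literature.MathematicalPhysics.QuantumFieldTheory.Balaban1983to89.T4OutputRate
  (Carriers Functional Window mem_window NE5 NE9 FadingMemory)

variable {C : Carriers}

/-! ## §1 Freezing a prefix of a coupling sequence: the slide paid by NE9's fading moduli -/

/-- The coupling sequence `g` with its OLDEST `m` couplings (indices `< m`) FROZEN at the common value `ε`. [folklore] -/
def frzSeq (m : ℕ) (ε : ℝ) (g : ℕ → ℝ) : ℕ → ℝ := fun i => if i < m then ε else g i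

/-- [bookkeeping] unfolding. [folklore] -/
theorem frzSeq_apply (m : ℕ) (ε : ℝ) (g : ℕ → ℝ) (i : ℕ) : frzSeq m ε g i = if i < m then ε else g i := rfl

/-- [bookkeeping] freezing nothing. [folklore] -/
@[simp] theorem frzSeq_zero (ε : ℝ) (g : ℕ → ℝ) : frzSeq 0 ε g = g := by
  funext i; simp [frzSeq]

/-- [bookkeeping] a frozen sequence stays in the window when `ε ∈ ]0,γ]`. [folklore] -/
theorem frzSeq_mem_window {m : ℕ} {γ ε : ℝ} {g : ℕ → ℝ} (hε0 : 0 < ε) (hεγ : ε ≤ γ) (hg : g ∈ Window γ) :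
    frzSeq m ε g ∈ Window γ := by
  intro i
  by_cases h : i < m
  · rw [frzSeq_apply, if_pos h]; exact ⟨hε0, hεγ⟩
  · rw [frzSeq_apply, if_neg h]; exact hg i

/-- ONE ENTRY: under `NE9 E (Window γ) κ Λ`, freezing one more coupling (index `m < scale X`) of a sequence in the window costs at most
`e^{−κd(X)}·Λ (scale X) m·γ` in `E · U X` (`0 ≤ Λ (scale X) m`); for `m ≥ scale X` it costs nothing (the scale-`j` term does not read
couplings born later — encoded in NE9's sum over `i < j`). [cite: Balaban1987RG1, §5 p.298] -/
theorem abs_sub_frzSeq_succ_le {Bg : Type} {E : Functional C Bg} {Λ : ℕ → ℕ → ℝ} {γ κ ε : ℝ} {m : ℕ} {g : ℕ → ℝ}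
    (h9 : NE9 E (Window γ) κ Λ) (hg : g ∈ Window γ) (hε0 : 0 < ε) (hεγ : ε ≤ γ) (U : Bg) (X : C.Dom)
    (hΛ0 : 0 ≤ Λ (C.scale X) m) :
    |E (frzSeq m ε g) U X - E (frzSeq (m + 1) ε g) U X|
      ≤ Real.exp (-(κ * C.d X)) * (if m < C.scale X then Λ (C.scale X) m * γ else 0) := by
  have h1 := frzSeq_mem_window (m := m) hε0 hεγ hg
  have h2 := frzSeq_mem_window (m := m + 1) hε0 hεγ hg
  have hLk := h9 _ h1 _ h2 U X
  have hsum : ∑ i ∈ range (C.scale X), Λ (C.scale X) i * |frzSeq m ε g i - frzSeq (m + 1) ε g i|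
      = if m < C.scale X then Λ (C.scale X) m * |g m - ε| else 0 := by
    split_ifs with hm
    · rw [Finset.sum_eq_single m]
      · simp [frzSeq_apply]
      · intro i _ hi
        by_cases h : i < m
        · rw [frzSeq_apply, frzSeq_apply, if_pos h, if_pos (Nat.lt_succ_of_lt h), sub_self, abs_zero, mul_zero]
        · have h' : ¬ i < m + 1 := by omega
          rw [frzSeq_apply, frzSeq_apply, if_neg h, if_neg h', sub_self, abs_zero, mul_zero]
      · intro h; exact absurd (mem_range.mpr hm) h
    · refine Finset.sum_eq_zero fun i hi => ?_
      have him : i < m := lt_of_lt_of_le (mem_range.mp hi) (not_lt.mp hm)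
      rw [frzSeq_apply, frzSeq_apply, if_pos him, if_pos (Nat.lt_succ_of_lt him), sub_self, abs_zero, mul_zero]
  rw [hsum] at hLk
  refine hLk.trans (mul_le_mul_of_nonneg_left ?_ (Real.exp_nonneg _))
  split_ifs with hm
  · have hgm := hg m
    have hdist : |g m - ε| ≤ γ := by
      rw [abs_sub_le_iff]; constructor <;> linarith [hgm.1, hgm.2]
    exact mul_le_mul_of_nonneg_left hdist hΛ0
  · exact le_rfl

/-- **THE PREFIX SLIDE AT THE ACTIVITY LEVEL.**  Under `NE9 E (Window γ) κ Λ` with `FadingMemory C₉ ω Λ` (`C₉ ≥ 0`, `0 ≤ ω < 1`, `γ > 0`),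
freezing the oldest `m ≤ scale X` couplings of `g ∈ Window γ` at any `ε ∈ ]0,γ]` moves `E g U X` by at most
`e^{−κd(X)}·C₉·γ·ω^{scale X + 1 − m}∕(1−ω)`. [cite: Balaban1987RG1, §5 p.298] -/
theorem abs_sub_frzSeq_le {Bg : Type} {E : Functional C Bg} {Λ : ℕ → ℕ → ℝ} {γ κ C₉ ω ε : ℝ} {g : ℕ → ℝ}
    (h9 : NE9 E (Window γ) κ Λ) (hΛ : FadingMemory C₉ ω Λ) (hC : 0 ≤ C₉) (hω0 : 0 ≤ ω) (hω1 : ω < 1) (hγ : 0 < γ)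
    (hg : g ∈ Window γ) (hε0 : 0 < ε) (hεγ : ε ≤ γ) (U : Bg) (X : C.Dom) :
    ∀ m, m ≤ C.scale X →
      |E g U X - E (frzSeq m ε g) U X| ≤ Real.exp (-(κ * C.d X)) * (C₉ * γ * ω ^ (C.scale X + 1 - m) / (1 - ω))
  | 0, _ => by
    rw [frzSeq_zero, sub_self, abs_zero]
    have h1 : 0 < 1 - ω := by linarith
    positivity
  | m + 1, hm => by
    have hmn : m < C.scale X := hm
    have ih := abs_sub_frzSeq_le h9 hΛ hC hω0 hω1 hγ hg hε0 hεγ U X m hmn.le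
    have hΛnm := hΛ (C.scale X) m hmn.le
    have hstep := abs_sub_frzSeq_succ_le h9 hg hε0 hεγ U X hΛnm.1
    rw [if_pos hmn] at hstep
    have h1 : 0 < 1 - ω := by linarith
    have e1 : C.scale X + 1 - m = (C.scale X - m) + 1 := by omega
    have e2 : C.scale X + 1 - (m + 1) = C.scale X - m := by omega
    have hexp := Real.exp_nonneg (-(κ * C.d X))
    calc |E g U X - E (frzSeq (m + 1) ε g) U X|
        ≤ |E g U X - E (frzSeq m ε g) U X| + |E (frzSeq m ε g) U X - E (frzSeq (m + 1) ε g) U X| := abs_sub_le _ _ _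
      _ ≤ Real.exp (-(κ * C.d X)) * (C₉ * γ * ω ^ (C.scale X + 1 - m) / (1 - ω))
          + Real.exp (-(κ * C.d X)) * (C₉ * ω ^ (C.scale X - m) * γ) :=
          add_le_add ih (hstep.trans (mul_le_mul_of_nonneg_left (mul_le_mul_of_nonneg_right hΛnm.2 hγ.le) hexp))
      _ = Real.exp (-(κ * C.d X)) * (C₉ * γ * ω ^ (C.scale X + 1 - (m + 1)) / (1 - ω)) := by
          rw [e1, e2, pow_succ]
          field_simp
          ring

/-! ## §2 NE5 ⟺ its frozen-prefix form, given the memory of BOTH runs' functionals -/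

/-- **THE TWO-RUN OUTPUT COMPARISON UP TO A FROZEN PREFIX.**  If BOTH `EA` (read through the transport) and `EB` have NE9-moduli fading at
rate `ω` on `Window γ`, then for every `g ∈ Window γ`, `U`, `X`, every `m ≤ scale X` and every `ε ∈ ]0,γ]`:
`|EA g (tr U) X − EB g U X| ≤ e^{−κd(X)}·2C₉γω^{scale X + 1 − m}∕(1−ω) + |EA (frz) (tr U) X − EB (frz) U X|`. [cite: Balaban1987RG1, (1.18) p.263 and §5 p.298] -/
theorem outputShift_le_frozen {EA : Functional C C.BgA} {EB : Functional C C.BgB} {ΛA ΛB : ℕ → ℕ → ℝ} {γ κ C₉ ω ε : ℝ}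
    {g : ℕ → ℝ} (h9A : NE9 EA (Window γ) κ ΛA) (h9B : NE9 EB (Window γ) κ ΛB)
    (hΛA : FadingMemory C₉ ω ΛA) (hΛB : FadingMemory C₉ ω ΛB) (hC : 0 ≤ C₉) (hω0 : 0 ≤ ω) (hω1 : ω < 1) (hγ : 0 < γ)
    (hg : g ∈ Window γ) (hε0 : 0 < ε) (hεγ : ε ≤ γ) (U : C.BgB) (X : C.Dom) {m : ℕ} (hm : m ≤ C.scale X) :
    |EA g (C.transport U) X - EB g U X|
      ≤ Real.exp (-(κ * C.d X)) * (2 * (C₉ * γ * ω ^ (C.scale X + 1 - m) / (1 - ω)))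
        + |EA (frzSeq m ε g) (C.transport U) X - EB (frzSeq m ε g) U X| := by
  have hA := abs_sub_frzSeq_le h9A hΛA hC hω0 hω1 hγ hg hε0 hεγ (C.transport U) X m hm
  have hB := abs_sub_frzSeq_le h9B hΛB hC hω0 hω1 hγ hg hε0 hεγ U X m hm
  rw [abs_sub_comm] at hB
  calc |EA g (C.transport U) X - EB g U X|
      = |(EA g (C.transport U) X - EA (frzSeq m ε g) (C.transport U) X)
          + (EA (frzSeq m ε g) (C.transport U) X - EB (frzSeq m ε g) U X)
          + (EB (frzSeq m ε g) U X - EB g U X)| := by ring_nf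
    _ ≤ |EA g (C.transport U) X - EA (frzSeq m ε g) (C.transport U) X|
          + |EA (frzSeq m ε g) (C.transport U) X - EB (frzSeq m ε g) U X|
          + |EB (frzSeq m ε g) U X - EB g U X| := abs_add_three _ _ _
    _ ≤ Real.exp (-(κ * C.d X)) * (C₉ * γ * ω ^ (C.scale X + 1 - m) / (1 - ω))
          + |EA (frzSeq m ε g) (C.transport U) X - EB (frzSeq m ε g) U X|
          + Real.exp (-(κ * C.d X)) * (C₉ * γ * ω ^ (C.scale X + 1 - m) / (1 - ω)) := add_le_add (add_le_add hA le_rfl) hB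
    _ = _ := by ring

/-- HYPOTHESIS SHAPE — NE5's comparison ON FROZEN-PREFIX COUPLING SEQUENCES ONLY, with an arbitrary two-parameter envelope `φ j m`: for every
`g ∈ Window γ`, `U`, `X` with `scale X = j`, every `m ≤ j` and every tolerance `η > 0` there is SOME freezing value `ε ∈ ]0,γ]` (e.g. only along
`ε → 0⁺`, the asymptotically free corner) with `|EA (frzSeq m ε g) (transport U) X − EB (frzSeq m ε g) U X| ≤ (φ j m + η)·e^{−κd(X)}`.
An UNPRINTED input, NOT a fact (cell NE5 is G-t4-U3-1). [cite: Balaban1987RG1, (1.18) p.263] -/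
def FrozenNE5 (EA : Functional C C.BgA) (EB : Functional C C.BgB) (γ κ : ℝ) (φ : ℕ → ℕ → ℝ) : Prop :=
  ∀ g ∈ Window γ, ∀ (U : C.BgB) (X : C.Dom) (m : ℕ), m ≤ C.scale X → ∀ η : ℝ, 0 < η →
    ∃ ε : ℝ, 0 < ε ∧ ε ≤ γ ∧
      |EA (frzSeq m ε g) (C.transport U) X - EB (frzSeq m ε g) U X| ≤ (φ (C.scale X) m + η) * Real.exp (-(κ * C.d X))

/-- **GENERAL ENVELOPES.**  `FrozenNE5 EA EB γ κ φ` + the fading moduli of both functionals ⇒ for every `g ∈ Window γ`, `U`, `X` and every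
`m ≤ scale X`: `|EA g (tr U) X − EB g U X| ≤ (2C₉γω^{scale X + 1 − m}∕(1−ω) + φ (scale X) m)·e^{−κd(X)}`. [folklore] -/
theorem outputEnvelope_of_frozenNE5 {EA : Functional C C.BgA} {EB : Functional C C.BgB} {ΛA ΛB : ℕ → ℕ → ℝ} {γ κ C₉ ω : ℝ}
    {φ : ℕ → ℕ → ℝ} (h9A : NE9 EA (Window γ) κ ΛA) (h9B : NE9 EB (Window γ) κ ΛB)
    (hΛA : FadingMemory C₉ ω ΛA) (hΛB : FadingMemory C₉ ω ΛB) (hC : 0 ≤ C₉) (hω0 : 0 ≤ ω) (hω1 : ω < 1) (hγ : 0 < γ)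
    (hF : FrozenNE5 EA EB γ κ φ) :
    ∀ g ∈ Window γ, ∀ (U : C.BgB) (X : C.Dom) (m : ℕ), m ≤ C.scale X →
      |EA g (C.transport U) X - EB g U X|
        ≤ (2 * (C₉ * γ * ω ^ (C.scale X + 1 - m) / (1 - ω)) + φ (C.scale X) m) * Real.exp (-(κ * C.d X)) := by
  intro g hg U X m hm
  have hexp := Real.exp_nonneg (-(κ * C.d X))
  refine le_of_forall_pos_le_add fun η hη => ?_
  obtain ⟨ε, hε0, hεγ, hφ⟩ := hF g hg U X m hm (η / (Real.exp (-(κ * C.d X)) + 1)) (by positivity)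
  have h := outputShift_le_frozen h9A h9B hΛA hΛB hC hω0 hω1 hγ hg hε0 hεγ U X hm
  have hηle : η / (Real.exp (-(κ * C.d X)) + 1) * Real.exp (-(κ * C.d X)) ≤ η := by
    rw [div_mul_eq_mul_div, div_le_iff₀ (by positivity)]
    nlinarith
  calc |EA g (C.transport U) X - EB g U X|
      ≤ Real.exp (-(κ * C.d X)) * (2 * (C₉ * γ * ω ^ (C.scale X + 1 - m) / (1 - ω)))
        + (φ (C.scale X) m + η / (Real.exp (-(κ * C.d X)) + 1)) * Real.exp (-(κ * C.d X)) := h.trans (add_le_add le_rfl hφ)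
    _ = (2 * (C₉ * γ * ω ^ (C.scale X + 1 - m) / (1 - ω)) + φ (C.scale X) m) * Real.exp (-(κ * C.d X))
        + η / (Real.exp (-(κ * C.d X)) + 1) * Real.exp (-(κ * C.d X)) := by ring
    _ ≤ _ := add_le_add le_rfl hηle

/-- **THE CONVERSE** (trivial): `NE5 EA EB (Window γ) κ θ C₅` gives `FrozenNE5 EA EB γ κ (fun j _ ↦ C₅·θ^j)` with `ε = γ`, `η` unused — frozen
sequences lie in the window.  So, GIVEN the memory, NE5 and its frozen-prefix form are EQUIVALENT up to constants and rates. [folklore] -/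
theorem frozenNE5_of_ne5 {EA : Functional C C.BgA} {EB : Functional C C.BgB} {γ κ θ C₅ : ℝ} (hγ : 0 < γ)
    (h5 : NE5 EA EB (Window γ) κ θ C₅) : FrozenNE5 EA EB γ κ (fun j _ => C₅ * θ ^ j) := by
  intro g hg U X m _ η hη
  refine ⟨γ, hγ, le_rfl, ?_⟩
  have h := h5 _ (frzSeq_mem_window (m := m) hγ le_rfl hg) U X
  have hexp := Real.exp_nonneg (-(κ * C.d X))
  calc |EA (frzSeq m γ g) (C.transport U) X - EB (frzSeq m γ g) U X|
      ≤ C₅ * θ ^ C.scale X * Real.exp (-(κ * C.d X)) := h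
    _ ≤ (C₅ * θ ^ C.scale X + η) * Real.exp (-(κ * C.d X)) := by nlinarith

/-! ## §3 Gain per frozen step, loss per live step: NE5's geometric rate with NO threshold -/

/-- **THE p : 1 SPLIT FOR NE5.**  Suppose the frozen comparison obeys `φ j m = a·Λ₁^{j−m}·θ₀^m` — GAIN `θ₀ ∈ [0,1]` per frozen step, LOSS
`Λ₁ ≥ 0` (of any size) per live step — and both functionals' moduli fade at rate `ω ∈ [0,1[`.  If `p : ℕ` and `θ′ ∈ ]0,1]` satisfy
`ω ≤ θ′^{p+1}` and `Λ₁·θ₀^p ≤ θ′^{p+1}`, then `NE5 EA EB (Window γ) κ θ′ ((2C₉γ∕(1−ω) + a)∕θ′^p)`: split the `j` history positions of a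
scale-`j` domain as `t = ⌊j∕(p+1)⌋` live and `j − t ≥ p·t` frozen.  NO condition relates `Λ₁` to `ω`. [folklore] -/
theorem ne5_of_frozenNE5_root {EA : Functional C C.BgA} {EB : Functional C C.BgB} {ΛA ΛB : ℕ → ℕ → ℝ}
    {γ κ C₉ ω a Λ₁ θ₀ θ' : ℝ} {p : ℕ} (h9A : NE9 EA (Window γ) κ ΛA) (h9B : NE9 EB (Window γ) κ ΛB)
    (hΛA : FadingMemory C₉ ω ΛA) (hΛB : FadingMemory C₉ ω ΛB) (hC : 0 ≤ C₉) (hω0 : 0 ≤ ω) (hω1 : ω < 1) (hγ : 0 < γ)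
    (ha : 0 ≤ a) (hΛ₁ : 0 ≤ Λ₁) (hθ0 : 0 ≤ θ₀) (hθ1 : θ₀ ≤ 1)
    (hθ'0 : 0 < θ') (hθ'1 : θ' ≤ 1) (hωθ' : ω ≤ θ' ^ (p + 1)) (hΛθ' : Λ₁ * θ₀ ^ p ≤ θ' ^ (p + 1))
    (hF : FrozenNE5 EA EB γ κ (fun j m => a * Λ₁ ^ (j - m) * θ₀ ^ m)) :
    NE5 EA EB (Window γ) κ θ' ((2 * (C₉ * γ / (1 - ω)) + a) / θ' ^ p) := by
  intro g hg U X
  set j := C.scale X with hj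
  set t := j / (p + 1) with ht
  have ht1 : (p + 1) * t ≤ j := Nat.mul_div_le j (p + 1)
  have ht2 : j < (p + 1) * (t + 1) := Nat.lt_mul_div_succ j (Nat.succ_pos p)
  have htk : t ≤ j := Nat.div_le_self _ _
  have hlin1 : (p + 1) * (t + 1) = (p + 1) * t + (p + 1) := by ring
  have hlin2 : (p + 1) * t = p * t + t := by ring
  have hm : j - t ≤ C.scale X := by rw [← hj]; exact Nat.sub_le _ _
  have henv := outputEnvelope_of_frozenNE5 h9A h9B hΛA hΛB hC hω0 hω1 hγ hF g hg U X (j - t) hm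
  rw [← hj] at henv
  have e1 : j + 1 - (j - t) = t + 1 := by omega
  have e2 : j - (j - t) = t := by omega
  rw [e1, e2] at henv
  have h1ω : 0 < 1 - ω := by linarith
  have hexp := Real.exp_nonneg (-(κ * C.d X))
  set ρ := θ' ^ (p + 1) with hρ
  have hρ0 : 0 ≤ ρ := pow_nonneg hθ'0.le _
  have hω1' : ω ≤ 1 := hω1.le
  have hωt : ω ^ (t + 1) ≤ ρ ^ t :=
    (pow_le_pow_of_le_one hω0 hω1' (Nat.le_succ t)).trans (pow_le_pow_left₀ hω0 hωθ' t)
  have hpt : p * t ≤ j - t := by omega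
  have hΛt : Λ₁ ^ t * θ₀ ^ (j - t) ≤ ρ ^ t := by
    calc Λ₁ ^ t * θ₀ ^ (j - t) ≤ Λ₁ ^ t * θ₀ ^ (p * t) :=
          mul_le_mul_of_nonneg_left (pow_le_pow_of_le_one hθ0 hθ1 hpt) (pow_nonneg hΛ₁ _)
      _ = (Λ₁ * θ₀ ^ p) ^ t := by rw [mul_pow, ← pow_mul]
      _ ≤ ρ ^ t := pow_le_pow_left₀ (mul_nonneg hΛ₁ (pow_nonneg hθ0 _)) hΛθ' t
  have hρt : ρ ^ t ≤ θ' ^ j / θ' ^ p := by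
    have hθ'p : 0 < θ' ^ p := pow_pos hθ'0 p
    rw [le_div_iff₀ hθ'p, hρ, ← pow_mul, ← pow_add]
    exact pow_le_pow_of_le_one hθ'0.le hθ'1 (by omega)
  have hK : 0 ≤ 2 * (C₉ * γ / (1 - ω)) + a := by positivity
  calc |EA g (C.transport U) X - EB g U X|
      ≤ (2 * (C₉ * γ * ω ^ (t + 1) / (1 - ω)) + a * Λ₁ ^ t * θ₀ ^ (j - t)) * Real.exp (-(κ * C.d X)) := henv
    _ = (2 * (C₉ * γ / (1 - ω)) * ω ^ (t + 1) + a * (Λ₁ ^ t * θ₀ ^ (j - t))) * Real.exp (-(κ * C.d X)) := by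
        field_simp
    _ ≤ (2 * (C₉ * γ / (1 - ω)) * ρ ^ t + a * ρ ^ t) * Real.exp (-(κ * C.d X)) :=
        mul_le_mul_of_nonneg_right
          (add_le_add (mul_le_mul_of_nonneg_left hωt (by positivity)) (mul_le_mul_of_nonneg_left hΛt ha)) hexp
    _ = (2 * (C₉ * γ / (1 - ω)) + a) * ρ ^ t * Real.exp (-(κ * C.d X)) := by ring
    _ ≤ (2 * (C₉ * γ / (1 - ω)) + a) * (θ' ^ j / θ' ^ p) * Real.exp (-(κ * C.d X)) :=
        mul_le_mul_of_nonneg_right (mul_le_mul_of_nonneg_left hρt hK) hexp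
    _ = (2 * (C₉ * γ / (1 - ω)) + a) / θ' ^ p * θ' ^ j * Real.exp (-(κ * C.d X)) := by ring

/-- **NE5's GEOMETRIC RATE FOR EVERY FINITE LOSS.**  Both functionals' moduli fading at rate `ω < 1` + a frozen comparison with gain
`θ₀ < 1` and ANY loss `Λ₁ ≥ 0` ⇒ `∃ C₅ ≥ 0, ∃ θ′ ∈ [0,1[, NE5 EA EB (Window γ) κ θ′ C₅` (choose `p` with `Λ₁θ₀^p < 1`, `θ′ = ρ^{1∕(p+1)}`).
The threshold-free statement one level up: RATE ⟸ MEMORY + frozen-prefix settling × bounded live amplification.  HYPOTHESES ONLY;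
nothing of rows NE5 ∕ NE9 is asserted. [folklore] -/
theorem exists_ne5_of_frozenNE5 {EA : Functional C C.BgA} {EB : Functional C C.BgB} {ΛA ΛB : ℕ → ℕ → ℝ}
    {γ κ C₉ ω a Λ₁ θ₀ : ℝ} (h9A : NE9 EA (Window γ) κ ΛA) (h9B : NE9 EB (Window γ) κ ΛB)
    (hΛA : FadingMemory C₉ ω ΛA) (hΛB : FadingMemory C₉ ω ΛB) (hC : 0 ≤ C₉) (hω0 : 0 ≤ ω) (hω1 : ω < 1) (hγ : 0 < γ)
    (ha : 0 ≤ a) (hΛ₁ : 0 ≤ Λ₁) (hθ0 : 0 ≤ θ₀) (hθ1 : θ₀ < 1)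
    (hF : FrozenNE5 EA EB γ κ (fun j m => a * Λ₁ ^ (j - m) * θ₀ ^ m)) :
    ∃ C₅ θ' : ℝ, 0 ≤ C₅ ∧ 0 ≤ θ' ∧ θ' < 1 ∧ NE5 EA EB (Window γ) κ θ' C₅ := by
  obtain ⟨p, hp⟩ : ∃ p : ℕ, θ₀ ^ p < 1 / (Λ₁ + 1) := exists_pow_lt_of_lt_one (by positivity) hθ1
  have hΛp : Λ₁ * θ₀ ^ p < 1 := by
    have hΛ1 : 0 < Λ₁ + 1 := by linarith
    calc Λ₁ * θ₀ ^ p ≤ (Λ₁ + 1) * θ₀ ^ p := mul_le_mul_of_nonneg_right (by linarith) (pow_nonneg hθ0 _)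
      _ < (Λ₁ + 1) * (1 / (Λ₁ + 1)) := mul_lt_mul_of_pos_left hp hΛ1
      _ = 1 := by field_simp
  set ρ := max (max ω (Λ₁ * θ₀ ^ p)) (1 / 2) with hρ
  have hρpos : 0 < ρ := lt_of_lt_of_le (by norm_num) (le_max_right _ _)
  have hρ1 : ρ < 1 := max_lt (max_lt hω1 hΛp) (by norm_num)
  have hωρ : ω ≤ ρ := (le_max_left _ _).trans (le_max_left _ _)
  have hΛρ : Λ₁ * θ₀ ^ p ≤ ρ := (le_max_right _ _).trans (le_max_left _ _)
  set θ' : ℝ := ρ ^ ((1 : ℝ) / (p + 1)) with hθ'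
  have hexp : 0 < (1 : ℝ) / (p + 1) := by positivity
  have hθ'0 : 0 < θ' := Real.rpow_pos_of_pos hρpos _
  have hθ'1 : θ' < 1 := Real.rpow_lt_one hρpos.le hρ1 hexp
  have hpow : θ' ^ (p + 1) = ρ := by
    rw [hθ', ← Real.rpow_natCast, ← Real.rpow_mul hρpos.le]
    have : (1 : ℝ) / (p + 1) * ((p + 1 : ℕ) : ℝ) = 1 := by
      rw [Nat.cast_add_one]; field_simp
    rw [this, Real.rpow_one]
  have h1ω : 0 < 1 - ω := by linarith
  refine ⟨(2 * (C₉ * γ / (1 - ω)) + a) / θ' ^ p, θ', by positivity, hθ'0.le, hθ'1, ?_⟩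
  exact ne5_of_frozenNE5_root h9A h9B hΛA hΛB hC hω0 hω1 hγ ha hΛ₁ hθ0 hθ1.le hθ'0 hθ'1.le
    (hωρ.trans hpow.symm.le) (hΛρ.trans hpow.symm.le) hF

end Summit.QuantumFields.BalabanUV.T4Continuum.Spine.NE4.OutputRateFrozenHistory

end
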